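import Summits.Ventures.PercRepro.CoarseTypes

/-!
# PercRepro — the type identity from the merge-type classification (typer-2, gen 3)

`LEAD-C011-concavity.md` §1–§2, part 2: the graph half of the type identity — the merge-type
classification — is typer-1's `MergeTypes.lean`; it is consumed here through the Prop-structure
**`MergeClassification`** (rows before / after opening `g` of each type, no move outside the types,
disjointness of the thirteen type events).  From it:

* `coarseMerge_eq_typeSum` — the pointwise decomposition of the coarse merge vector into the
  indicator combination of the five type vectors;
* `prob_update_zero_eq_of_indep`, `type*_update_mem` — the type events do not see the coordinate
  `g`, so their `p[g := 0]`-probabilities are their `p`-probabilities;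
* **`deltaQuad_eq_of_classification`** — `Q⁺(Δ_g, Δ_g) = sixMarkLHS − sixMarkRHS`;
* **`TypeIdentity_of_classification`** — `TypeIdentity` from the classification.
-/

namespace PercRepro

open Finset

namespace MultiGraph

variable {V E : Type*} (G : MultiGraph V E) [Fintype E] [DecidableEq E]

/-- **The merge-type classification along `g`** (the graph half of the type identity, typer-1's
`MergeTypes.lean`): the rows before and after opening `g` of a configuration of each type, the
absence of a move outside the types, and the disjointness of the thirteen type events. -/
structure MergeClassification (g : E) (a b c d : V) : Prop where
  rowsA : ∀ i ω, ω ∈ G.typeA g a b c d i → G.rowClosed g ![a, b, c, d] ω = 14 ∧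
    (G.rowOpened g ![a, b, c, d] ω = r1Row i ∨ G.rowOpened g ![a, b, c, d] ω = r2Row i)
  rowsB : ∀ i ω, ω ∈ G.typeB g a b c d i →
    (G.rowClosed g ![a, b, c, d] ω = r1Row i ∨ G.rowClosed g ![a, b, c, d] ω = r2Row i) ∧
    G.rowOpened g ![a, b, c, d] ω = xRow i
  rowsC : ∀ i ω, ω ∈ G.typeC g a b c d i →
    (G.rowClosed g ![a, b, c, d] ω = r1Row i ∨ G.rowClosed g ![a, b, c, d] ω = r2Row i) ∧
    G.rowOpened g ![a, b, c, d] ω ∈ threeOneRows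
  rowsD : ∀ i ω, ω ∈ G.typeD g a b c d i → G.rowClosed g ![a, b, c, d] ω = xRow i ∧
    G.rowOpened g ![a, b, c, d] ω = 0
  rowsE : ∀ ω, ω ∈ G.typeE g a b c d → G.rowClosed g ![a, b, c, d] ω ∈ threeOneRows ∧
    G.rowOpened g ![a, b, c, d] ω = 0
  noMove : ∀ ω, (∀ i, ω ∉ G.typeA g a b c d i) → (∀ i, ω ∉ G.typeB g a b c d i) →
    (∀ i, ω ∉ G.typeC g a b c d i) → (∀ i, ω ∉ G.typeD g a b c d i) → ω ∉ G.typeE g a b c d →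
    G.rowOpened g ![a, b, c, d] ω = G.rowClosed g ![a, b, c, d] ω
  disjAA : ∀ i j, i ≠ j → Disjoint (G.typeA g a b c d i) (G.typeA g a b c d j)
  disjBB : ∀ i j, i ≠ j → Disjoint (G.typeB g a b c d i) (G.typeB g a b c d j)
  disjCC : ∀ i j, i ≠ j → Disjoint (G.typeC g a b c d i) (G.typeC g a b c d j)
  disjDD : ∀ i j, i ≠ j → Disjoint (G.typeD g a b c d i) (G.typeD g a b c d j)
  disjAB : ∀ i j, Disjoint (G.typeA g a b c d i) (G.typeB g a b c d j)
  disjAC : ∀ i j, Disjoint (G.typeA g a b c d i) (G.typeC g a b c d j)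
  disjAD : ∀ i j, Disjoint (G.typeA g a b c d i) (G.typeD g a b c d j)
  disjAE : ∀ i, Disjoint (G.typeA g a b c d i) (G.typeE g a b c d)
  disjBC : ∀ i j, Disjoint (G.typeB g a b c d i) (G.typeC g a b c d j)
  disjBD : ∀ i j, Disjoint (G.typeB g a b c d i) (G.typeD g a b c d j)
  disjBE : ∀ i, Disjoint (G.typeB g a b c d i) (G.typeE g a b c d)
  disjCD : ∀ i j, Disjoint (G.typeC g a b c d i) (G.typeD g a b c d j)
  disjCE : ∀ i, Disjoint (G.typeC g a b c d i) (G.typeE g a b c d)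
  disjDE : ∀ i, Disjoint (G.typeD g a b c d i) (G.typeE g a b c d)

end MultiGraph

/-! ### The type identity from the classification -/

/-- The indicator of an event, as a real function. -/
noncomputable def ind {E : Type*} (T : Set (Config E)) (ω : Config E) : ℝ :=
  T.indicator (fun _ => (1 : ℝ)) ω

/-- The indicator of a member. -/
theorem ind_of_mem {E : Type*} {T : Set (Config E)} {ω : Config E} (h : ω ∈ T) : ind T ω = 1 := by
  simp [ind, h]

/-- The indicator of a non-member. -/
theorem ind_of_notMem {E : Type*} {T : Set (Config E)} {ω : Config E} (h : ω ∉ T) :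
    ind T ω = 0 := by
  simp [ind, h]

/-- `Σ_ω w(ω)·1_T(ω) = P(T)`. -/
theorem sum_weight_mul_ind {E : Type*} [Fintype E] [DecidableEq E] (p : E → ℝ)
    (T : Set (Config E)) : ∑ ω : Config E, weight p ω * ind T ω = prob p T := by
  classical
  unfold prob
  refine Finset.sum_congr rfl fun ω _ => ?_
  by_cases h : ω ∈ T
  · rw [ind_of_mem h, Set.indicator_of_mem h, mul_one]
  · rw [ind_of_notMem h, Set.indicator_of_notMem h, mul_zero]

/-- A family of pairwise disjoint events with one member: the indicator sum collapses. -/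
theorem sum_ind_mul_of_mem {E : Type*} {T : Fin 3 → Set (Config E)} {ω : Config E} {i : Fin 3}
    (hi : ω ∈ T i) (hdisj : ∀ j, j ≠ i → ω ∉ T j) (v : Fin 3 → Fin 9 → ℝ) (c : Fin 9) :
    ∑ j, ind (T j) ω * v j c = v i c := by
  rw [Finset.sum_eq_single i]
  · rw [ind_of_mem hi, one_mul]
  · intro j _ hj
    rw [ind_of_notMem (hdisj j hj), zero_mul]
  · intro h; exact absurd (Finset.mem_univ i) h

/-- A family of events with no member: the indicator sum vanishes. -/
theorem sum_ind_mul_of_notMem {E : Type*} {T : Fin 3 → Set (Config E)} {ω : Config E}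
    (h : ∀ j, ω ∉ T j) (v : Fin 3 → Fin 9 → ℝ) (c : Fin 9) :
    ∑ j, ind (T j) ω * v j c = 0 :=
  Finset.sum_eq_zero fun j _ => by rw [ind_of_notMem (h j), zero_mul]

namespace MultiGraph

variable {V E : Type*} (G : MultiGraph V E) [Fintype E] [DecidableEq E]

omit [Fintype E] in
/-- **The pointwise decomposition**: under the classification, the coarse merge vector of every
configuration is the indicator combination of the five type vectors. -/
theorem coarseMerge_eq_typeSum {g : E} {a b c d : V} (h : G.MergeClassification g a b c d)
    (ω : Config E) :
    G.coarseMerge g ![a, b, c, d] ω = fun r =>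
      (∑ i, ind (G.typeA g a b c d i) ω * vA i r) + (∑ i, ind (G.typeB g a b c d i) ω * vB i r) +
        (∑ i, ind (G.typeC g a b c d i) ω * vC i r) + (∑ i, ind (G.typeD g a b c d i) ω * vD i r) +
        ind (G.typeE g a b c d) ω * vE r := by
  funext r
  by_cases hA : ∃ i, ω ∈ G.typeA g a b c d i
  · obtain ⟨i, hi⟩ := hA
    have hB : ∀ j, ω ∉ G.typeB g a b c d j := fun j => Set.disjoint_left.mp (h.disjAB i j) hi
    have hC : ∀ j, ω ∉ G.typeC g a b c d j := fun j => Set.disjoint_left.mp (h.disjAC i j) hi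
    have hD : ∀ j, ω ∉ G.typeD g a b c d j := fun j => Set.disjoint_left.mp (h.disjAD i j) hi
    have hE : ω ∉ G.typeE g a b c d := Set.disjoint_left.mp (h.disjAE i) hi
    rw [sum_ind_mul_of_mem hi (fun j hj => Set.disjoint_left.mp (h.disjAA i j hj.symm) hi),
      sum_ind_mul_of_notMem hB, sum_ind_mul_of_notMem hC, sum_ind_mul_of_notMem hD,
      ind_of_notMem hE]
    obtain ⟨h0, h1⟩ := h.rowsA i ω hi
    simp only [coarseMerge, h0, coarseOf_bot, vA, zero_mul, add_zero]
    rcases h1 with h1 | h1 <;> rw [h1] <;> simp only [coarseOf_r1Row, coarseOf_r2Row]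
  by_cases hB : ∃ i, ω ∈ G.typeB g a b c d i
  · obtain ⟨i, hi⟩ := hB
    have hA' : ∀ j, ω ∉ G.typeA g a b c d j := fun j => Set.disjoint_right.mp (h.disjAB j i) hi
    have hC : ∀ j, ω ∉ G.typeC g a b c d j := fun j => Set.disjoint_left.mp (h.disjBC i j) hi
    have hD : ∀ j, ω ∉ G.typeD g a b c d j := fun j => Set.disjoint_left.mp (h.disjBD i j) hi
    have hE : ω ∉ G.typeE g a b c d := Set.disjoint_left.mp (h.disjBE i) hi
    rw [sum_ind_mul_of_mem hi (fun j hj => Set.disjoint_left.mp (h.disjBB i j hj.symm) hi),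
      sum_ind_mul_of_notMem hA', sum_ind_mul_of_notMem hC, sum_ind_mul_of_notMem hD,
      ind_of_notMem hE]
    obtain ⟨h0, h1⟩ := h.rowsB i ω hi
    simp only [coarseMerge, h1, coarseOf_xRow, vB, zero_mul, add_zero, zero_add]
    rcases h0 with h0 | h0 <;> rw [h0] <;> simp only [coarseOf_r1Row, coarseOf_r2Row]
  by_cases hC : ∃ i, ω ∈ G.typeC g a b c d i
  · obtain ⟨i, hi⟩ := hC
    have hA' : ∀ j, ω ∉ G.typeA g a b c d j := fun j => Set.disjoint_right.mp (h.disjAC j i) hi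
    have hB' : ∀ j, ω ∉ G.typeB g a b c d j := fun j => Set.disjoint_right.mp (h.disjBC j i) hi
    have hD : ∀ j, ω ∉ G.typeD g a b c d j := fun j => Set.disjoint_left.mp (h.disjCD i j) hi
    have hE : ω ∉ G.typeE g a b c d := Set.disjoint_left.mp (h.disjCE i) hi
    rw [sum_ind_mul_of_mem hi (fun j hj => Set.disjoint_left.mp (h.disjCC i j hj.symm) hi),
      sum_ind_mul_of_notMem hA', sum_ind_mul_of_notMem hB', sum_ind_mul_of_notMem hD,
      ind_of_notMem hE]
    obtain ⟨h0, h1⟩ := h.rowsC i ω hi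
    simp only [coarseMerge, coarseOf_threeOne _ h1, vC, zero_mul, add_zero, zero_add]
    rcases h0 with h0 | h0 <;> rw [h0] <;> simp only [coarseOf_r1Row, coarseOf_r2Row]
  by_cases hD : ∃ i, ω ∈ G.typeD g a b c d i
  · obtain ⟨i, hi⟩ := hD
    have hA' : ∀ j, ω ∉ G.typeA g a b c d j := fun j => Set.disjoint_right.mp (h.disjAD j i) hi
    have hB' : ∀ j, ω ∉ G.typeB g a b c d j := fun j => Set.disjoint_right.mp (h.disjBD j i) hi
    have hC' : ∀ j, ω ∉ G.typeC g a b c d j := fun j => Set.disjoint_right.mp (h.disjCD j i) hi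
    have hE : ω ∉ G.typeE g a b c d := Set.disjoint_left.mp (h.disjDE i) hi
    rw [sum_ind_mul_of_mem hi (fun j hj => Set.disjoint_left.mp (h.disjDD i j hj.symm) hi),
      sum_ind_mul_of_notMem hA', sum_ind_mul_of_notMem hB', sum_ind_mul_of_notMem hC',
      ind_of_notMem hE]
    obtain ⟨h0, h1⟩ := h.rowsD i ω hi
    simp only [coarseMerge, h0, h1, coarseOf_xRow, coarseOf_top, vD, zero_mul, add_zero, zero_add]
  by_cases hE : ω ∈ G.typeE g a b c d
  · have hA' : ∀ j, ω ∉ G.typeA g a b c d j := fun j => Set.disjoint_right.mp (h.disjAE j) hE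
    have hB' : ∀ j, ω ∉ G.typeB g a b c d j := fun j => Set.disjoint_right.mp (h.disjBE j) hE
    have hC' : ∀ j, ω ∉ G.typeC g a b c d j := fun j => Set.disjoint_right.mp (h.disjCE j) hE
    have hD' : ∀ j, ω ∉ G.typeD g a b c d j := fun j => Set.disjoint_right.mp (h.disjDE j) hE
    rw [sum_ind_mul_of_notMem hA', sum_ind_mul_of_notMem hB', sum_ind_mul_of_notMem hC',
      sum_ind_mul_of_notMem hD', ind_of_mem hE]
    obtain ⟨h0, h1⟩ := h.rowsE ω hE
    simp only [coarseMerge, coarseOf_threeOne _ h0, h1, coarseOf_top, vE, zero_add, one_mul]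
  · push Not at hA hB hC hD
    rw [sum_ind_mul_of_notMem hA, sum_ind_mul_of_notMem hB, sum_ind_mul_of_notMem hC,
      sum_ind_mul_of_notMem hD, ind_of_notMem hE]
    simp only [coarseMerge, h.noMove ω hA hB hC hD hE, sub_self, zero_mul, add_zero]

omit [Fintype E] in
/-- `ConnWithout g` does not see the coordinate `g`. -/
theorem connWithout_update (g : E) (ω : Config E) (b : Bool) (x y : V) :
    G.ConnWithout g (Function.update ω g b) x y ↔ G.ConnWithout g ω x y := by
  simp only [ConnWithout, Function.update_idem]

omit [Fintype E] in
/-- The type events do not see the coordinate `g`. -/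
theorem typeA_update_mem (g : E) (a b c d : V) (i : Fin 3) (ω : Config E) (β : Bool) :
    Function.update ω g β ∈ G.typeA g a b c d i ↔ ω ∈ G.typeA g a b c d i := by
  simp only [typeA, sepAllFour, linksPair, Set.mem_setOf_eq, connWithout_update]

omit [Fintype E] in
/-- The type events do not see the coordinate `g`. -/
theorem typeB_update_mem (g : E) (a b c d : V) (i : Fin 3) (ω : Config E) (β : Bool) :
    Function.update ω g β ∈ G.typeB g a b c d i ↔ ω ∈ G.typeB g a b c d i := by
  simp only [typeB, isRank1Cell, linksPair, Set.mem_setOf_eq, connWithout_update]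

omit [Fintype E] in
/-- The type events do not see the coordinate `g`. -/
theorem typeC_update_mem (g : E) (a b c d : V) (i : Fin 3) (ω : Config E) (β : Bool) :
    Function.update ω g β ∈ G.typeC g a b c d i ↔ ω ∈ G.typeC g a b c d i := by
  simp only [typeC, isRank1Cell, linksPair, Set.mem_setOf_eq, connWithout_update]

omit [Fintype E] in
/-- The type events do not see the coordinate `g`. -/
theorem typeD_update_mem (g : E) (a b c d : V) (i : Fin 3) (ω : Config E) (β : Bool) :
    Function.update ω g β ∈ G.typeD g a b c d i ↔ ω ∈ G.typeD g a b c d i := by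
  simp only [typeD, isCrossCell, linksPair, Set.mem_setOf_eq, connWithout_update]

omit [Fintype E] in
/-- The type events do not see the coordinate `g`. -/
theorem typeE_update_mem (g : E) (a b c d : V) (ω : Config E) (β : Bool) :
    Function.update ω g β ∈ G.typeE g a b c d ↔ ω ∈ G.typeE g a b c d := by
  simp only [typeE, isThreeOneCell, linksPair, Set.mem_setOf_eq, connWithout_update]

end MultiGraph

/-- An event that does not see the coordinate `g` has the same probability under `p` and
`p[g := 0]`. -/
theorem prob_update_zero_eq_of_indep {E : Type*} [Fintype E] [DecidableEq E] (p : E → ℝ) (g : E)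
    {A : Set (Config E)} (hA : ∀ ω, Function.update ω g true ∈ A ↔ ω ∈ A) :
    prob (Function.update p g 0) A = prob p A := by
  have h1 : prob (Function.update p g 1) A = prob (Function.update p g 0) A := by
    rw [prob_update_one_eq_preimage_true]
    congr 1
    ext ω
    exact hA ω
  have := prob_update p g (p g) A
  rw [Function.update_eq_self] at this
  rw [this, h1]
  ring

/-- Pulling the configuration sum inside an indicator block. -/
theorem sum_weight_block {E : Type*} [Fintype E] [DecidableEq E] (w : Config E → ℝ)
    (T : Fin 3 → Set (Config E))
    (v : Fin 3 → Fin 9 → ℝ) (r : Fin 9) :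
    ∑ ω : Config E, w ω * ∑ i, ind (T i) ω * v i r =
      ∑ i, (∑ ω : Config E, w ω * ind (T i) ω) * v i r := by
  simp only [Finset.mul_sum, Finset.sum_mul]
  rw [Finset.sum_comm]
  refine Finset.sum_congr rfl fun i _ => Finset.sum_congr rfl fun ω _ => ?_
  ring

namespace MultiGraph

variable {V E : Type*} (G : MultiGraph V E) [Fintype E] [DecidableEq E]

/-- **The type identity from the classification**: `Q⁺(Δ_g, Δ_g) = sixMarkLHS − sixMarkRHS`. -/
theorem deltaQuad_eq_of_classification {g : E} {a b c d : V}
    (h : G.MergeClassification g a b c d) (p : E → ℝ) :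
    G.deltaQuad p g a b c d = G.sixMarkLHS p g a b c d - G.sixMarkRHS p g a b c d := by
  rw [deltaQuad_eq_sum_sum]
  simp only [quadPlus_eq_coarseForm, coarseVec_mergeVec]
  rw [coarseForm_sum_sum]
  have hsum : (fun r => ∑ ω : Config E, weight (Function.update p g 0) ω *
      G.coarseMerge g ![a, b, c, d] ω r) = fun r =>
      (∑ i, prob p (G.typeA g a b c d i) * vA i r) +
        (∑ i, prob p (G.typeB g a b c d i) * vB i r) +
        (∑ i, prob p (G.typeC g a b c d i) * vC i r) +
        (∑ i, prob p (G.typeD g a b c d i) * vD i r) +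
        prob p (G.typeE g a b c d) * vE r := by
    funext r
    simp only [G.coarseMerge_eq_typeSum h]
    simp only [mul_add, Finset.sum_add_distrib, sum_weight_block, sum_weight_mul_ind,
      ← Finset.sum_mul, ← mul_assoc]
    rw [prob_update_zero_eq_of_indep p g (fun ω => G.typeE_update_mem g a b c d ω true)]
    simp only [fun i => prob_update_zero_eq_of_indep p g (fun ω => G.typeA_update_mem g a b c d i ω true),
      fun i => prob_update_zero_eq_of_indep p g (fun ω => G.typeB_update_mem g a b c d i ω true),
      fun i => prob_update_zero_eq_of_indep p g (fun ω => G.typeC_update_mem g a b c d i ω true),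
      fun i => prob_update_zero_eq_of_indep p g (fun ω => G.typeD_update_mem g a b c d i ω true)]
  rw [hsum, coarseForm_typeSum]
  simp only [sixMarkLHS, sixMarkRHS, Fin.sum_univ_three]
  simp only [ne_eq, Fin.reduceEq, not_false_eq_true, if_true, if_false, not_true_eq_false,
    zero_add, add_zero]
  ring

end MultiGraph

/-- **The type identity holds whenever the classification holds.** -/
theorem TypeIdentity_of_classification
    (h : ∀ {V E : Type} [Fintype E] [DecidableEq E] (G : MultiGraph V E) (g : E) (a b c d : V),
      G.MergeClassification g a b c d) : TypeIdentity :=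
  fun G p _ a b c d g => G.deltaQuad_eq_of_classification (h G g a b c d) p

end PercRepro
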